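import Literature.Probability.Percolation.AdjExitTight
import HarnessLib

/-!
# Surgery for the adjacent landing, same side: two exits of one colour from a pair structure

Topic `Literature/Probability/Percolation`; family `crit-perc` / near-critical percolation on `𝕋`.
A brick of the near-critical arm-separation theorem for four arms in the ADJACENT colour
arrangement (P. Nolin, EJP 13 (2008), Thm. 11, `j = 4`, `σ = BBWW` [arXiv 0711.4948: Thm. 10],
§4.4 Lemma 15 [arXiv Lemma 14] for two arms of one colour behind the SAME side): from a pair
structure `PairData` (two disjoint arms of the colour from `∂Λ_n` to the outer side of the
trapezoid behind side `0`, the exploration of the lowest crossings good at some scale at every term)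
the two clean routes of `PairData.exists_two_clean_routes` give two EXITS (`TrapExit`) at the tips of
two distinct terms, with everything the covering lemma consumes (`OutMidExits4`, same-colour
clauses): the routes start at the arm starts, lie in the exit regions of the configuration, are tight
outside `Λ_{2M}` (`ExitTight`), the two structures (route and corner box) are disjoint, both exits
are fences FROM BELOW (nominal tip = tip of the term), their tips are tips of open crossings with the
raw protections (`TrapRawOK`), and the two tips are `17k` apart in the scale of the lower one
(`PairData.row_gap_of_lt`); the provenance of the routes (arms, terms and the fence) is kept.

* `PairData.corner_rows` — the corner box of a fence sits in the rows `[z₁ + k, z₁ + 2k]` beyond the side;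
* **`PairData.exists_exits_prov`** — the statement above, with the provenance of the routes (arms,
  terms and the fence); `PairData.exists_exits` — without it.

Everything here is proved; no named facts are introduced.

## References

* P. Nolin, Near-critical percolation in two dimensions, *Electron. J. Probab.* 13 (2008), §4.2
  Def. 6–8, §4.4 Lemma 15 (arXiv 0711.4948: Def. 6–8, Lemma 14), σ = BBWW [Nolin2008].
-/

noncomputable section

open Set

namespace Literature.Probability.Percolation

open LatticeModels
open PairData (term_isCrossing term_eq tip_mem term_open term_norm_le tip_lt_of_lt)

namespace PairData

variable {M n k₀ K T : ℕ} {χ : SiteConfig (Site 2)}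

/-- **Rows of a structure beyond the side**: every site of `S ∪ corner box` (route to the fence of the
term `u`, tip `z`, scale `k`) outside `Λ_{2M}` lies in the rows `(z₁, z₁ + 2k + 1]`. [folklore] -/
theorem route_or_corner_rows (D : PairData M n k₀ K T χ) {u : ℕ} {c : Finset (Site 2)} {z : Site 2}
    (hu : (trapDomain M).lowestSeq χ u = some (c, z)) {S : Set (Site 2)} (hS : S ⊆ D.Bset ∪ (D.fence hu).F) {v : Site 2}
    (hv : v ∈ S ∪ triStrip (z 0 + D.kOf hu) (z 1 + D.kOf hu) (D.kOf hu) (D.kOf hu)) (hvn : 2 * (M : ℤ) < triNorm v) :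
    z 1 < v 1 ∧ v 1 ≤ z 1 + (2 * D.kOf hu + 1) := by
  rcases hv with hv | hv
  · have hvF := D.clean_route_exterior hu hS hv hvn
    have hb := fenceSet_box ((D.fence hu).F_subset hvF)
    exact ⟨mem_fenceSet_outside ((D.fence hu).F_subset hvF) hvn, hb.2.2.2⟩
  · rw [mem_triStrip] at hv
    have hk := D.one_le_kOf hu
    constructor <;> omega

/-- Sites of the corner box lie beyond the side (`z ∈ trapO`, `1 ≤ k`). [folklore] -/
theorem corner_norm (D : PairData M n k₀ K T χ) {u : ℕ} {c : Finset (Site 2)} {z : Site 2}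
    (hu : (trapDomain M).lowestSeq χ u = some (c, z)) {v : Site 2}
    (hv : v ∈ triStrip (z 0 + D.kOf hu) (z 1 + D.kOf hu) (D.kOf hu) (D.kOf hu)) : 2 * (M : ℤ) < triNorm v := by
  rw [mem_triStrip] at hv
  have hz := (mem_trapO.1 (tip_mem hu)).2
  have hk := D.one_le_kOf hu
  have h0 : 2 * (M : ℤ) < v 0 := by omega
  exact lt_of_lt_of_le h0 (le_triNorm_iff_lin.2 (Or.inl le_rfl))

/-- **Two exits of one colour behind the same side**, with the provenance of the routes. [cite: Nolin2008, §4.4 Lemma 15 (arXiv 0711.4948: Lemma 14), σ = BBWW (two arms of one colour, one U-shaped region)] -/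
theorem exists_exits_prov (D : PairData M n k₀ K T χ) :
    ∃ (u₀ u₁ : ℕ) (c₀ c₁ : Finset (Site 2)) (z₀ z₁ : Site 2)
      (hu₀ : (trapDomain M).lowestSeq χ u₀ = some (c₀, z₀)) (hu₁ : (trapDomain M).lowestSeq χ u₁ = some (c₁, z₁)),
      u₀ ≠ u₁ ∧ ∃ (F₀ F₁ : TrapExit M n k₀ K χ) (S₀ S₁ : Set (Site 2)),
        F₀.a = D.a 0 ∧ F₁.a = D.a 1 ∧ F₀.z = z₀ ∧ F₁.z = z₁ ∧ F₀.k = D.kOf hu₀ ∧ F₁.k = D.kOf hu₁ ∧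
        PathIn triGraph S₀ F₀.a F₀.m ∧ PathIn triGraph S₁ F₁.a F₁.m ∧
        S₀ ⊆ (triAnnSet n (2 * M) ∪ trapExitZone M F₀.z F₀.k) ∩ χ ∧ S₁ ⊆ (triAnnSet n (2 * M) ∪ trapExitZone M F₁.z F₁.k) ∩ χ ∧
        (∀ v ∈ S₀, 2 * (M : ℤ) < triNorm v → ExitTight F₀.z F₀.k v) ∧ (∀ v ∈ S₁, 2 * (M : ℤ) < triNorm v → ExitTight F₁.z F₁.k v) ∧
        Disjoint (S₀ ∪ triStrip (F₀.z 0 + F₀.k) (F₀.z 1 + F₀.k) F₀.k F₀.k) (S₁ ∪ triStrip (F₁.z 0 + F₁.k) (F₁.z 1 + F₁.k) F₁.k F₁.k) ∧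
        S₀ ⊆ D.Bset ∪ (D.fence hu₀).F ∧ S₁ ⊆ D.Bset ∪ (D.fence hu₁).F := by
  obtain ⟨u₀, u₁, c₀, c₁, z₀, z₁, hu₀, hu₁, hne, S₀, S₁, hP₀, hP₁, hS₀, hS₁, hdj⟩ := D.exists_two_clean_routes
  refine ⟨u₀, u₁, c₀, c₁, z₀, z₁, hu₀, hu₁, hne, (D.exitOfRoute 0 hu₀ hP₀ hS₀).toTrapExit, (D.exitOfRoute 1 hu₁ hP₁ hS₁).toTrapExit, S₀, S₁,
    rfl, rfl, rfl, rfl, rfl, rfl, hP₀, hP₁, ?_, ?_, D.exitOfRoute_tight 0 hu₀ hP₀ hS₀, D.exitOfRoute_tight 1 hu₁ hP₁ hS₁, ?_, hS₀, hS₁⟩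
  · exact (D.clean_route_region hu₀ hS₀).trans (Set.inter_subset_inter_left _ (Set.union_subset_union_right _ trapFrameZone_subset_trapExitZone))
  · exact (D.clean_route_region hu₁ hS₁).trans (Set.inter_subset_inter_left _ (Set.union_subset_union_right _ trapFrameZone_subset_trapExitZone))
  · -- the two structures are disjoint: the routes by Menger, the rest by the norm and the row gap
    show Disjoint (S₀ ∪ triStrip (z₀ 0 + D.kOf hu₀) (z₀ 1 + D.kOf hu₀) (D.kOf hu₀) (D.kOf hu₀))
      (S₁ ∪ triStrip (z₁ 0 + D.kOf hu₁) (z₁ 1 + D.kOf hu₁) (D.kOf hu₁) (D.kOf hu₁))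
    rw [Set.disjoint_left]
    intro v hv₀ hv₁
    -- a common site is beyond the side (else it is a common site of the two routes)
    have hvn : 2 * (M : ℤ) < triNorm v := by
      rcases hv₀ with hv₀ | hv₀
      · rcases hv₁ with hv₁ | hv₁
        · exact absurd hv₁ (Set.disjoint_left.1 hdj hv₀)
        · exact D.corner_norm hu₁ hv₁
      · exact D.corner_norm hu₀ hv₀
    obtain ⟨a₀, b₀⟩ := D.route_or_corner_rows hu₀ hS₀ hv₀ hvn
    obtain ⟨a₁, b₁⟩ := D.route_or_corner_rows hu₁ hS₁ hv₁ hvn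
    rcases Nat.lt_or_gt_of_ne hne with hlt | hlt
    · have hgap := D.row_gap_of_lt hlt hu₀ hu₁; omega
    · have hgap := D.row_gap_of_lt hlt hu₁ hu₀; omega

/-- **Two exits of one colour behind the same side.** [cite: Nolin2008, §4.4 Lemma 15 (arXiv 0711.4948: Lemma 14), σ = BBWW (two arms of one colour, one U-shaped region)] -/
theorem exists_exits (D : PairData M n k₀ K T χ) :
    ∃ (u₀ u₁ : ℕ) (c₀ c₁ : Finset (Site 2)) (z₀ z₁ : Site 2)
      (hu₀ : (trapDomain M).lowestSeq χ u₀ = some (c₀, z₀)) (hu₁ : (trapDomain M).lowestSeq χ u₁ = some (c₁, z₁)),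
      u₀ ≠ u₁ ∧ ∃ (F₀ F₁ : TrapExit M n k₀ K χ) (S₀ S₁ : Set (Site 2)),
        F₀.a = D.a 0 ∧ F₁.a = D.a 1 ∧ F₀.z = z₀ ∧ F₁.z = z₁ ∧ F₀.k = D.kOf hu₀ ∧ F₁.k = D.kOf hu₁ ∧
        PathIn triGraph S₀ F₀.a F₀.m ∧ PathIn triGraph S₁ F₁.a F₁.m ∧
        S₀ ⊆ (triAnnSet n (2 * M) ∪ trapExitZone M F₀.z F₀.k) ∩ χ ∧ S₁ ⊆ (triAnnSet n (2 * M) ∪ trapExitZone M F₁.z F₁.k) ∩ χ ∧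
        (∀ v ∈ S₀, 2 * (M : ℤ) < triNorm v → ExitTight F₀.z F₀.k v) ∧ (∀ v ∈ S₁, 2 * (M : ℤ) < triNorm v → ExitTight F₁.z F₁.k v) ∧
        Disjoint (S₀ ∪ triStrip (F₀.z 0 + F₀.k) (F₀.z 1 + F₀.k) F₀.k F₀.k) (S₁ ∪ triStrip (F₁.z 0 + F₁.k) (F₁.z 1 + F₁.k) F₁.k F₁.k) := by
  obtain ⟨u₀, u₁, c₀, c₁, z₀, z₁, hu₀, hu₁, hne, F₀, F₁, S₀, S₁, h1, h2, h3, h4, h5, h6, h7, h8, h9, h10, h11, h12, h13, -, -⟩ :=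
    D.exists_exits_prov
  exact ⟨u₀, u₁, c₀, c₁, z₀, z₁, hu₀, hu₁, hne, F₀, F₁, S₀, S₁, h1, h2, h3, h4, h5, h6, h7, h8, h9, h10, h11, h12, h13⟩

end PairData

end Literature.Probability.Percolation
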